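import Literature.Probability.RandomPlanarGeometry.SAWTriangularEndpointKesten
import Literature.Probability.RandomPlanarGeometry.SAWTriangularPolygonGrowth
import HarnessLib

/-!
# The lower envelope of `c_N(0,x)` on `𝕋` from the polygon insertion, and Theorem 7.3.4(b) from the insertion alone

Topic `Literature/Probability/RandomPlanarGeometry` (lane «pcv-sawmu», item «TRI-ENDPOINT»; continues
`SAWTriangularEndpointKesten.lean`; uses `SAWTriangularPolygonGrowth.lean`: the envelope
`|log t_N − N log μ(𝕋)| ≤ (53 + 3 log μ(𝕋)) √N` of the rooted oriented polygons `t_N = triLoopCount N`).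
Source: N. Madras, G. Slade, *The Self-Avoiding Walk* (1993), Corollary 3.2.6 (p. 67: for `x ≠ 0`,
`c_N(0,x)^{1/N} → μ`, printed for `ℤ^d` along the parity of `‖x‖₁`; its proof inserts a polygon into a fixed walk
from `0` to `x`) and Theorem 7.3.4(b) (p. 248).  On `𝕋` (not bipartite: no parity) this file proves:

* `TriEndpoint.exists_mem_triSLx` — for every `x ≠ 0` and every `T` there is a self-avoiding walk of `𝕋` from `0`
  to `x` with at least `T` steps (an explicit three-segment staircase, written inline), whence, with the one-step monotonicity
  `c_n(0,x) ≤ 4 c_{n+1}(0,x)` of `SAWTriangularEndpointMonotone`, **`one_le_card_triSLx_of_le`**: `c_n(0,x) ≥ 1` for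
  all `n ≥ n₀(x)`;
* **`triEndpointLo_of_ins`** — the quantitative Corollary 3.2.6 on `𝕋`: a polygon-insertion inequality
  `c_n(0,x) · t_m ≤ Z (n+m+k)^6 c_{n+m+k}(0,x)` (`n ≥ n₁`, `m ≥ 3`; the lane's face `TriEndpointIns x`, taken verbatim as
  a hypothesis) gives `e^{−c√N} μ(𝕋)^N ≤ c_N(0,x)` for `N ≥ N₁(x)`;
* **`tendsto_card_triSLx_ratio_of_ins`** — `c_{N+1}(0,x)/c_N(0,x) → μ(𝕋)` for `x ≠ 0` from the insertion inequality
  alone (Theorem 7.3.4(b) on `𝕋`, one step), by `tendsto_card_triSLx_ratio_of_envelope`.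
-/

noncomputable section

open Finset Filter Topology Literature.Probability.LatticeModels Literature.Probability.Percolation SimpleGraph

namespace Literature.Probability.RandomPlanarGeometry.SAW

namespace TriEndpoint

/-! ### Explicit long walks from `0` to `x ≠ 0` -/

/-- Two sites with the same coordinates are equal. [folklore] -/
private theorem site_ext {s t : Site 2} (h0 : s 0 = t 0) (h1 : s 1 = t 1) : s = t := by
  funext i
  fin_cases i
  · exact h0
  · exact h1

/-- A coordinate path `f` with `f 0 = 0`, consecutive values adjacent in `𝕋` and no repeated value on `[0, n]` lists a
walk of `S_n(f n)`. [cite: MadrasSlade1993, §1.1] -/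
theorem map_range_mem_triSLx {f : ℕ → Site 2} {n : ℕ} (h0 : f 0 = 0)
    (hadj : ∀ i, i < n → triGraph.Adj (f i) (f (i + 1)))
    (hinj : ∀ i j, i ≤ n → j ≤ n → f i = f j → i = j) :
    (List.range (n + 1)).map f ∈ triSLx n (f n) := by
  have hget : ∀ i, i ≤ n → ((List.range (n + 1)).map f).getD i 0 = f i := by
    intro i hi
    rw [List.getD_eq_getElem?_getD, List.getElem?_map, List.getElem?_range (by omega)]
    rfl
  refine mem_triSLx.2 ⟨mem_triSL_of (by simp) (by rw [hget 0 (Nat.zero_le _), h0]) (fun i hi => ?_) ?_, hget n le_rfl⟩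
  · rw [hget i (by omega), hget (i + 1) hi]
    exact hadj i (by omega)
  · exact (List.nodup_range (n := n + 1)).map_on fun i hi j hj e =>
      hinj i j (by have := List.mem_range.1 hi; omega) (by have := List.mem_range.1 hj; omega) e

/-- **For every `x ≠ 0` and every `T` there is a self-avoiding walk of `𝕋` from `0` to `x` with at least `T` steps**:
for `x = (a, b)` with `a ≠ 0` the staircase up the column `0` to height `D = T + |b|`, along the row `D` to the column
`a`, down the column `a` to `b`; for `x = (0, b)` (`b ≠ 0`) the staircase along the row `0` to the column `T`, up or
down the column `T` to the row `b`, back along the row `b` to the column `0`.  Adjacency and self-avoidance are linear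
arithmetic on the coordinates. [cite: MadrasSlade1993, Corollary 3.2.6 (proof)] -/
theorem exists_mem_triSLx (x : Site 2) (hx : x ≠ 0) (T : ℕ) : ∃ n : ℕ, T ≤ n ∧ 1 ≤ #(triSLx n x) := by
  by_cases ha : x 0 = 0
  · -- `x = (0, b)`, `b ≠ 0`
    have hb : x 1 ≠ 0 := by
      intro hb
      exact hx (site_ext (by rw [ha]; rfl) (by rw [hb]; rfl))
    set B : ℕ := (x 1).natAbs with hBdef
    have hB : (((B : ℕ) : ℤ) = x 1 ∧ 0 < x 1) ∨ (((B : ℕ) : ℤ) = -(x 1) ∧ x 1 < 0) := by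
      rcases Int.natAbs_eq (x 1) with h | h <;> omega
    set f : ℕ → Site 2 := fun i =>
      if i ≤ T then ![(i : ℤ), 0]
      else if i ≤ T + B then ![(T : ℤ), if 0 < x 1 then (i : ℤ) - T else (T : ℤ) - i]
      else ![((T : ℤ) + T + B) - i, x 1] with hf
    have h0 : f 0 = 0 := by simp [hf]
    have hadj : ∀ i, i < T + B + T → triGraph.Adj (f i) (f (i + 1)) := by
      intro i _
      rw [triGraph_adj_iff_adj_zero_sub, triGraph_adj_zero_iff]
      simp only [hf, Pi.sub_apply]
      split_ifs <;> simp only [Matrix.cons_val_zero, Matrix.cons_val_one] <;> omega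
    have hinj : ∀ i j, i ≤ T + B + T → j ≤ T + B + T → f i = f j → i = j := by
      intro i j _ _ e
      have e0 := congrFun e 0
      have e1 := congrFun e 1
      simp only [hf] at e0 e1
      split_ifs at e0 e1 <;> simp only [Matrix.cons_val_zero, Matrix.cons_val_one] at e0 e1 <;> omega
    have hmem := map_range_mem_triSLx h0 hadj hinj
    have hend : f (T + B + T) = x := by
      refine site_ext ?_ ?_ <;> simp only [hf] <;> split_ifs <;>
        simp only [Matrix.cons_val_zero, Matrix.cons_val_one] <;> push_cast <;> omega
    rw [hend] at hmem
    exact ⟨_, by omega, Finset.card_pos.2 ⟨_, hmem⟩⟩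
  · -- `x = (a, b)`, `a ≠ 0`
    set A : ℕ := (x 0).natAbs with hAdef
    have hA : (((A : ℕ) : ℤ) = x 0 ∧ 0 < x 0) ∨ (((A : ℕ) : ℤ) = -(x 0) ∧ x 0 < 0) := by
      rcases Int.natAbs_eq (x 0) with h | h <;> omega
    set D : ℕ := T + (x 1).natAbs with hD
    have hDb : x 1 ≤ (D : ℤ) := by
      have hc : (D : ℤ) = (T : ℤ) + (((x 1).natAbs : ℕ) : ℤ) := by simp only [hD, Nat.cast_add]
      rcases Int.natAbs_eq (x 1) with h | h <;> omega
    set E : ℕ := ((D : ℤ) - x 1).toNat with hE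
    have hE' : (E : ℤ) = D - x 1 := by rw [hE, Int.toNat_of_nonneg (by omega)]
    set f : ℕ → Site 2 := fun i =>
      if i ≤ D then ![0, (i : ℤ)]
      else if i ≤ D + A then ![if 0 < x 0 then (i : ℤ) - D else (D : ℤ) - i, (D : ℤ)]
      else ![x 0, ((D : ℤ) + D + A) - i] with hf
    have h0 : f 0 = 0 := by simp [hf]
    have hadj : ∀ i, i < D + A + E → triGraph.Adj (f i) (f (i + 1)) := by
      intro i _
      rw [triGraph_adj_iff_adj_zero_sub, triGraph_adj_zero_iff]
      simp only [hf, Pi.sub_apply]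
      split_ifs <;> simp only [Matrix.cons_val_zero, Matrix.cons_val_one] <;> omega
    have hinj : ∀ i j, i ≤ D + A + E → j ≤ D + A + E → f i = f j → i = j := by
      intro i j _ _ e
      have e0 := congrFun e 0
      have e1 := congrFun e 1
      simp only [hf] at e0 e1
      split_ifs at e0 e1 <;> simp only [Matrix.cons_val_zero, Matrix.cons_val_one] at e0 e1 <;> omega
    have hmem := map_range_mem_triSLx h0 hadj hinj
    have hend : f (D + A + E) = x := by
      refine site_ext ?_ ?_ <;> simp only [hf] <;> split_ifs <;>
        simp only [Matrix.cons_val_zero, Matrix.cons_val_one] <;> push_cast <;> omega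
    rw [hend] at hmem
    exact ⟨_, by omega, Finset.card_pos.2 ⟨_, hmem⟩⟩

/-- **`c_n(0,x) ≥ 1` for all large `n`** (`x ≠ 0`): one long walk (`exists_mem_triSLx`) beyond the threshold of the
one-step monotonicity `c_n(0,x) ≤ 4 c_{n+1}(0,x)`, then induction. [cite: MadrasSlade1993, Corollary 3.2.6 and Lemma 7.3.3] -/
theorem one_le_card_triSLx_of_le (x : Site 2) (hx : x ≠ 0) : ∃ n₀ : ℕ, ∀ n : ℕ, n₀ ≤ n → 1 ≤ #(triSLx n x) := by
  obtain ⟨N₀, hmono⟩ := exists_card_triSLx_le_four_mul x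
  obtain ⟨n₁, hn₁, h1⟩ := exists_mem_triSLx x hx N₀
  refine ⟨n₁, fun n hn => ?_⟩
  induction n, hn using Nat.le_induction with
  | base => exact h1
  | succ n hn ih =>
    have h := hmono n (by omega)
    omega

/-! ### The envelope from the polygon insertion -/

/-- `log N ≤ 2 √N` for `N ≥ 1`. [folklore] -/
private theorem log_le_two_sqrt' {N : ℝ} (hN : 1 ≤ N) : Real.log N ≤ 2 * Real.sqrt N := by
  have hs : 0 < Real.sqrt N := Real.sqrt_pos.2 (by linarith)
  have h1 : Real.log (Real.sqrt N) ≤ Real.sqrt N - 1 := Real.log_le_sub_one_of_pos hs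
  have h2 : Real.log N = 2 * Real.log (Real.sqrt N) := by
    rw [← Real.log_rpow hs, Real.rpow_two, Real.sq_sqrt (by linarith)]
  rw [h2]
  linarith

end TriEndpoint

open TriEndpoint

/-- **The quantitative Corollary 3.2.6 on `𝕋`** (lower envelope of `c_N(0,x)`, `x ≠ 0`, from the polygon insertion):
if `c_n(0,x) · t_m ≤ Z (n+m+k)^6 · c_{n+m+k}(0,x)` for `n ≥ n₁`, `m ≥ 3` (the lane's face `TriEndpointIns x`), then
`e^{−c√N} μ(𝕋)^N ≤ c_N(0,x)` for `N ≥ N₁`: fix one `n* ≥ n₁` with `c_{n*}(0,x) ≥ 1` (`one_le_card_triSLx_of_le`), so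
`t_m ≤ Z N^6 c_N(0,x)` with `N = n* + m + k`, and use the polygon envelope `log t_m ≥ m log μ(𝕋) − (53 + 3 log μ(𝕋))√m`
(`abs_log_triLoopCount_sub_le`), absorbing `μ^{−(n*+k)}`, `Z` and `N^6` into `e^{−c√N}`.
[cite: MadrasSlade1993, Corollary 3.2.6 (p. 67) and Theorem 3.2.3 (3.2.5)] -/
theorem triEndpointLo_of_ins (x : Site 2) (hx : x ≠ 0)
    (hins : ∃ Z k n₁ : ℕ, ∀ n m : ℕ, n₁ ≤ n → 3 ≤ m →
      #(triSLx n x) * triLoopCount m ≤ Z * (n + m + k) ^ 6 * #(triSLx (n + m + k) x)) :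
    ∃ c : ℝ, 0 ≤ c ∧ ∃ N₁ : ℕ, ∀ N : ℕ, N₁ ≤ N →
      Real.exp (-(c * Real.sqrt N)) * Real.exp logMuTri ^ N ≤ #(triSLx N x) := by
  obtain ⟨Z, k, n₁, hZ⟩ := hins
  obtain ⟨n₀, hn₀⟩ := one_le_card_triSLx_of_le x hx
  set n' : ℕ := max n₀ n₁ with hn'
  set L : ℝ := logMuTri with hLdef
  have hL : 0 ≤ L := logMuTri_pos.le
  set C : ℝ := 53 + 3 * L with hCdef
  have hC : 0 ≤ C := by positivity
  -- the insertion with `c_{n'}(0,x) ≥ 1`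
  have hkey : ∀ m : ℕ, 3 ≤ m →
      (triLoopCount m : ℝ) ≤ (Z : ℝ) * (((n' + m + k : ℕ) : ℝ)) ^ 6 * #(triSLx (n' + m + k) x) := by
    intro m hm
    have hS : 1 ≤ #(triSLx n' x) := hn₀ _ (le_max_left _ _)
    have h := hZ n' m (le_max_right _ _) hm
    have h' : triLoopCount m ≤ Z * (n' + m + k) ^ 6 * #(triSLx (n' + m + k) x) :=
      le_trans (by simpa using Nat.mul_le_mul_right (triLoopCount m) hS) h
    exact_mod_cast h'
  -- `Z ≥ 1` (from `t_4 > 0`)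
  have hZ1 : (1 : ℝ) ≤ Z := by
    have h4 := hkey 4 (by norm_num)
    have ht := (abs_log_triLoopCount_sub_le (N := 4) le_rfl).1
    have hZ0 : Z ≠ 0 := by
      rintro rfl
      simp only [Nat.cast_zero, zero_mul] at h4
      linarith
    exact_mod_cast Nat.one_le_iff_ne_zero.2 hZ0
  set c : ℝ := ((n' : ℝ) + k) * L + C + Real.log Z + 12 with hcdef
  have hlogZ : 0 ≤ Real.log Z := Real.log_nonneg hZ1
  refine ⟨c, by positivity, n' + k + 4, fun N hN => ?_⟩
  -- `N = n' + m + k` with `m ≥ 4`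
  obtain ⟨m, hm4, rfl⟩ : ∃ m, 4 ≤ m ∧ N = n' + m + k := ⟨N - n' - k, by omega, by omega⟩
  obtain ⟨htpos, henv⟩ := abs_log_triLoopCount_sub_le (N := m) hm4
  have hk := hkey m (by omega)
  set Nr : ℝ := ((n' + m + k : ℕ) : ℝ) with hNr
  have hN1 : (1 : ℝ) ≤ Nr := by rw [hNr]; exact_mod_cast (show 1 ≤ n' + m + k by omega)
  have hN0 : (0 : ℝ) < Nr := by linarith
  have hS0 : (0 : ℝ) < #(triSLx (n' + m + k) x) := by
    exact_mod_cast hn₀ _ (by omega)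
  -- (1) `t_m / (Z N^6) ≤ c_N(0,x)`
  have hden : (0 : ℝ) < (Z : ℝ) * Nr ^ 6 := by positivity
  have h1 : (triLoopCount m : ℝ) / ((Z : ℝ) * Nr ^ 6) ≤ #(triSLx (n' + m + k) x) := by
    rw [div_le_iff₀ hden]
    calc (triLoopCount m : ℝ) ≤ (Z : ℝ) * Nr ^ 6 * #(triSLx (n' + m + k) x) := hk
      _ = #(triSLx (n' + m + k) x) * ((Z : ℝ) * Nr ^ 6) := by ring
  refine le_trans ?_ h1
  -- (2) `e^{−c√N} μ^N ≤ t_m / (Z N^6)`, in logarithms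
  rw [le_div_iff₀ hden]
  have hm0 : (0 : ℝ) ≤ m := Nat.cast_nonneg m
  have hmN : (m : ℝ) ≤ Nr := by rw [hNr]; exact_mod_cast (show m ≤ n' + m + k by omega)
  have hsqN1 : 1 ≤ Real.sqrt Nr := by rw [← Real.sqrt_one]; exact Real.sqrt_le_sqrt hN1
  have hsqm : Real.sqrt m ≤ Real.sqrt Nr := Real.sqrt_le_sqrt hmN
  have hlogN : Real.log Nr ≤ 2 * Real.sqrt Nr := log_le_two_sqrt' hN1
  -- `log t_m ≥ m L − C √m`
  have hlogt : (m : ℝ) * L - C * Real.sqrt m ≤ Real.log (triLoopCount m) := by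
    have := (abs_le.1 henv).1
    linarith
  -- the exponent comparison
  have hexp : -(c * Real.sqrt Nr) + Nr * L + Real.log Z + 6 * Real.log Nr ≤ (m : ℝ) * L - C * Real.sqrt m := by
    have hNm : Nr * L = (m : ℝ) * L + ((n' : ℝ) + k) * L := by
      rw [hNr]; push_cast; ring
    rw [hNm, hcdef]
    have h1' : ((n' : ℝ) + k) * L ≤ ((n' : ℝ) + k) * L * Real.sqrt Nr :=
      le_mul_of_one_le_right (by positivity) hsqN1
    have h2' : C * Real.sqrt m ≤ C * Real.sqrt Nr := mul_le_mul_of_nonneg_left hsqm hC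
    have h3' : Real.log Z ≤ Real.log Z * Real.sqrt Nr := le_mul_of_one_le_right hlogZ hsqN1
    nlinarith
  -- conclude: both sides as exponentials
  have hlhs : Real.exp (-(c * Real.sqrt Nr)) * Real.exp L ^ (n' + m + k) * ((Z : ℝ) * Nr ^ 6) =
      Real.exp (-(c * Real.sqrt Nr) + Nr * L + Real.log Z + 6 * Real.log Nr) := by
    rw [Real.exp_add, Real.exp_add, Real.exp_add, Real.exp_log (by positivity), ← Real.exp_nat_mul,
      show (6 : ℝ) * Real.log Nr = ((6 : ℕ) : ℝ) * Real.log Nr by norm_num, ← Real.log_pow,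
      Real.exp_log (by positivity), hNr]
    ring
  rw [hlhs]
  calc Real.exp (-(c * Real.sqrt Nr) + Nr * L + Real.log Z + 6 * Real.log Nr)
      ≤ Real.exp ((m : ℝ) * L - C * Real.sqrt m) := Real.exp_le_exp.2 hexp
    _ ≤ Real.exp (Real.log (triLoopCount m)) := Real.exp_le_exp.2 hlogt
    _ = triLoopCount m := Real.exp_log htpos

/-- **Kesten's inequality for `S_N(x)` from the insertion** (`x ≠ 0`). [cite: MadrasSlade1993, Lemma 7.3.1 (7.3.1) and
Theorem 7.3.2(c)] -/
theorem kestenIneqTriEndpoint_of_ins (x : Site 2) (hx : x ≠ 0)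
    (hins : ∃ Z k n₁ : ℕ, ∀ n m : ℕ, n₁ ≤ n → 3 ≤ m →
      #(triSLx n x) * triLoopCount m ≤ Z * (n + m + k) ^ 6 * #(triSLx (n + m + k) x)) :
    ∃ D : ℝ, ∀ᶠ N : ℕ in atTop,
      ((#(triSLx (N + 1) x) : ℝ) / #(triSLx N x)) ^ 2 - D / N ≤
        ((#(triSLx (N + 1) x) : ℝ) / #(triSLx N x)) * ((#(triSLx (N + 2) x) : ℝ) / #(triSLx (N + 1) x)) := by
  obtain ⟨c, hc, N₁, hlo⟩ := triEndpointLo_of_ins x hx hins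
  exact kestenIneqTriEndpoint_of x hc hlo

/-- **Madras–Slade Theorem 7.3.4(b) on the triangular lattice, one step, from the polygon insertion alone**: for
`x ≠ 0`, `c_{N+1}(0,x)/c_N(0,x) → μ(𝕋)`, given the insertion inequality `TriEndpointIns x`.
[cite: MadrasSlade1993, Theorem 7.3.4(b) (p. 248), Corollary 3.2.6, Lemma 7.3.1, Lemma 7.3.3] -/
theorem tendsto_card_triSLx_ratio_of_ins (x : Site 2) (hx : x ≠ 0)
    (hins : ∃ Z k n₁ : ℕ, ∀ n m : ℕ, n₁ ≤ n → 3 ≤ m →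
      #(triSLx n x) * triLoopCount m ≤ Z * (n + m + k) ^ 6 * #(triSLx (n + m + k) x)) :
    Tendsto (fun N : ℕ => (#(triSLx (N + 1) x) : ℝ) / #(triSLx N x)) atTop (𝓝 (Real.exp logMuTri)) := by
  obtain ⟨c, hc, N₁, hlo⟩ := triEndpointLo_of_ins x hx hins
  exact tendsto_card_triSLx_ratio_of_envelope x hc hlo

end Literature.Probability.RandomPlanarGeometry.SAW
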